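import Summits.QuantumFields.BalabanUV.Beta.D1BFx.MixedVarPackedHess
import Literature.MathematicalPhysics.QuantumFieldTheory.Balaban1983to89.Beta.Composition

/-!
# `BalabanUV.Beta.FP.KktUnitConjugation` — road «FP» for binder row D1, ROUTE T, memo `N2B-DESIGN.md` §35 (the unit of `hId` at the (T-ID) assembly):
# **A UNIT-SCALED KKT SYSTEM `kkt (c⁻¹ • H) Q` HAS THE UNIT-CONJUGATE OF ANY RIGHT INVERSE OF `kkt H Q` AS A RIGHT INVERSE, AND UNDER THAT CONJUGATION OF THE
# LEG `hessT` MOVES THE UNIT ONTO THE FIELD BLOCKS OF THE JETS**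

WHY.  The coarse system of the level-0 door (#37c `LevelZeroDoorSocketCompanion`) is `kkt S.toBlocks₁₁ [Q₂₀; τ₂]` with `S` the fine system's effective form;
leaf-05's `RelInvPeriodisedCombTorusLetters.hId_comb` identifies `S.toBlocks₁₁ = (wVH d Lc 1)⁻¹ • 𝕄₁|ff` — the next level's chart form UP TO A UNIT — while
leaf-05's comb-slice letters (`PackedLegBlocksAtSlices.packedLeg_comb_eq ∕ kkt_mul_inv_comb`) invert the UNSCALED `kkt 𝕄₁|ff [Q₂₀; τ₂]`.  THIS FILE is the
[folklore] algebra bridging the two for the assembly #40 `LevelZeroLawFullIndex`: `kkt (c⁻¹•H) Q = D_L·kkt H Q·D_R` (block-scalar diagonals), hence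
`D_R⁻¹·X·D_L⁻¹` is a right inverse of the scaled system when `kkt H Q·X = 1` (§1); the block-scalar factors are diagonals, restriction along any map commutes
with diagonal factors, and conjugating the LEG by `diag(1,c⁻¹)`, `diag(c,1)` inside `hessT` against GRADED first-order blocks and a `kkt` second-order block
IS multiplying the three field blocks by `c` (trace cyclicity) (§1 (U3)–(U5)).  Pure matrix algebra over `Composition.kkt` and `MixedVarPackedHess.hessT`;
no `def`, no `def … : Prop`, nothing cited, 0 sorry; 0 estimates.

HONEST DEPENDENCY (page 1, mandatory): continuum YM on T⁴ ⇐ BetaPertH ∧ nine spine estimates (0/9 proved); BetaPertH ⇐ (D1) ∧ (D4) ∧ CAP+tail;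
G-an2-4 gates asym, D1 and NE2/3/4.  HONEST FRAMING (cell contract, verbatim): «discharging `BetaPertH` makes Bałaban's UV stability UNCONDITIONAL —
a real constructive-QFT result; it is NOT the continuum limit and NOT the Clay problem.»  ABSOLUTE RULE (cell charter, verbatim): «No internally-minted
statement may enter as a cited fact. Every hypothesis is either kernel-proved in this package or a verbatim quotation of a PUBLISHED theorem with page
reference. The manuscript(s) under audit are NOT citable for their own disputed steps — they are the thing under adjudication; programme-internal
(2001/route/tribunal) claims are never citable.»  Nothing of Bałaban's asserted; 0∕4 row-D1 binders (hW, hR, D1Tel, D1Rep); NOT (T-ID), NOT SDF, NOT D1,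
NOT BetaPertH, NOT continuum, NOT Clay.  Road «FP» OWNER, b2b-balaban-beta-d1-p3 gen 26, 2026-08-23.  No existing file touched.
-/

noncomputable section

open scoped BigOperators Matrix

namespace Summit.QuantumFields.BalabanUV.Beta.FP.KktUnitConjugation

open Matrix
open Literature.MathematicalPhysics.QuantumFieldTheory.Balaban1983to89.Beta.Composition (kkt)
open Summit.QuantumFields.BalabanUV.Beta.D1BFx.MixedVarPackedHess (hessT)

/-! ## §1 The unit conjugation: a right inverse of a unit-scaled KKT system, and `hessT`'s blocks under it -/

section Unit

variable {ν μ : Type*} [Fintype ν] [Fintype μ] [DecidableEq ν] [DecidableEq μ]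

/-- [folklore] (U1) `kkt (c⁻¹ • H) Q = D_L · kkt H Q · D_R` with `D_L = fromBlocks (c⁻¹ • 1) 0 0 1`, `D_R = fromBlocks 1 0 0 (c • 1)`. -/
theorem kkt_inv_smul_eq (c : ℝ) (hc : c ≠ 0) (H : Matrix ν ν ℝ) (Q : Matrix μ ν ℝ) :
    kkt (c⁻¹ • H) Q = fromBlocks (c⁻¹ • (1 : Matrix ν ν ℝ)) 0 0 (1 : Matrix μ μ ℝ) * kkt H Q * fromBlocks (1 : Matrix ν ν ℝ) 0 0 (c • (1 : Matrix μ μ ℝ)) := by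
  unfold kkt
  simp only [fromBlocks_multiply, Matrix.mul_zero, Matrix.zero_mul, add_zero, zero_add, Matrix.one_mul, Matrix.mul_one, Matrix.smul_mul,
    Matrix.mul_smul, smul_zero, smul_smul, mul_inv_cancel₀ hc, one_smul]

/-- [folklore] (U2) **a right inverse of the unit-scaled system from a right inverse of the unscaled one**: if `kkt H Q · X = 1` then
`kkt (c⁻¹ • H) Q · (D_R⁻¹ · X · D_L⁻¹) = 1`, `D_R⁻¹ = fromBlocks 1 0 0 (c⁻¹ • 1)`, `D_L⁻¹ = fromBlocks (c • 1) 0 0 1`. -/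
theorem kkt_inv_smul_mul_rightInverse (c : ℝ) (hc : c ≠ 0) (H : Matrix ν ν ℝ) (Q : Matrix μ ν ℝ) (X : Matrix (ν ⊕ μ) (ν ⊕ μ) ℝ)
    (hX : kkt H Q * X = 1) :
    kkt (c⁻¹ • H) Q * (fromBlocks (1 : Matrix ν ν ℝ) 0 0 (c⁻¹ • (1 : Matrix μ μ ℝ)) * X * fromBlocks (c • (1 : Matrix ν ν ℝ)) 0 0 (1 : Matrix μ μ ℝ)) = 1 := by
  have h1 : fromBlocks (1 : Matrix ν ν ℝ) 0 0 (c • (1 : Matrix μ μ ℝ)) * fromBlocks (1 : Matrix ν ν ℝ) 0 0 (c⁻¹ • (1 : Matrix μ μ ℝ)) = 1 := by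
    simp only [fromBlocks_multiply, Matrix.mul_zero, Matrix.zero_mul, add_zero, zero_add, Matrix.one_mul, Matrix.smul_mul, Matrix.mul_smul,
      smul_zero, smul_smul, inv_mul_cancel₀ hc, one_smul, fromBlocks_one]
  have h2 : fromBlocks (c⁻¹ • (1 : Matrix ν ν ℝ)) 0 0 (1 : Matrix μ μ ℝ) * fromBlocks (c • (1 : Matrix ν ν ℝ)) 0 0 (1 : Matrix μ μ ℝ) = 1 := by
    simp only [fromBlocks_multiply, Matrix.mul_zero, Matrix.zero_mul, add_zero, zero_add, Matrix.one_mul, Matrix.smul_mul, Matrix.mul_smul,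
      smul_zero, smul_smul, mul_inv_cancel₀ hc, one_smul, fromBlocks_one]
  rw [kkt_inv_smul_eq c hc]
  calc fromBlocks (c⁻¹ • (1 : Matrix ν ν ℝ)) 0 0 1 * kkt H Q * fromBlocks 1 0 0 (c • (1 : Matrix μ μ ℝ))
        * (fromBlocks 1 0 0 (c⁻¹ • (1 : Matrix μ μ ℝ)) * X * fromBlocks (c • (1 : Matrix ν ν ℝ)) 0 0 1)
      = fromBlocks (c⁻¹ • (1 : Matrix ν ν ℝ)) 0 0 1
          * (kkt H Q * ((fromBlocks 1 0 0 (c • (1 : Matrix μ μ ℝ)) * fromBlocks 1 0 0 (c⁻¹ • (1 : Matrix μ μ ℝ))) * X))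
          * fromBlocks (c • (1 : Matrix ν ν ℝ)) 0 0 1 := by simp only [Matrix.mul_assoc]
    _ = 1 := by rw [h1, Matrix.one_mul, hX, Matrix.mul_one, h2]

omit [Fintype ν] [Fintype μ] in
/-- [folklore] the block unit factors ARE diagonals. -/
theorem fromBlocks_units_eq_diagonal (a b : ℝ) :
    fromBlocks (a • (1 : Matrix ν ν ℝ)) 0 0 (b • (1 : Matrix μ μ ℝ)) = Matrix.diagonal (Sum.elim (fun _ : ν => a) (fun _ : μ => b)) := by
  ext (i | i) (j | j)
  · simp only [fromBlocks_apply₁₁, Matrix.smul_apply, Matrix.one_apply, smul_eq_mul, mul_ite, mul_one, mul_zero, diagonal_apply, Sum.elim_inl, Sum.inl.injEq]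
  · simp only [fromBlocks_apply₁₂, Matrix.zero_apply, diagonal_apply, reduceCtorEq, ↓reduceIte]
  · simp only [fromBlocks_apply₂₁, Matrix.zero_apply, diagonal_apply, reduceCtorEq, ↓reduceIte]
  · simp only [fromBlocks_apply₂₂, Matrix.smul_apply, Matrix.one_apply, smul_eq_mul, mul_ite, mul_one, mul_zero, diagonal_apply, Sum.elim_inr, Sum.inr.injEq]

omit [Fintype ν] [Fintype μ] in
/-- [folklore] the right unit factor `fromBlocks 1 0 0 (b • 1)` is a diagonal. -/
theorem fromBlocks_one_units_eq_diagonal (b : ℝ) :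
    fromBlocks (1 : Matrix ν ν ℝ) 0 0 (b • (1 : Matrix μ μ ℝ)) = Matrix.diagonal (Sum.elim (fun _ : ν => (1 : ℝ)) (fun _ : μ => b)) := by
  simpa only [one_smul] using fromBlocks_units_eq_diagonal (ν := ν) (μ := μ) (1 : ℝ) b

omit [Fintype ν] [Fintype μ] in
/-- [folklore] the left unit factor `fromBlocks (a • 1) 0 0 1` is a diagonal. -/
theorem fromBlocks_units_one_eq_diagonal (a : ℝ) :
    fromBlocks (a • (1 : Matrix ν ν ℝ)) 0 0 (1 : Matrix μ μ ℝ) = Matrix.diagonal (Sum.elim (fun _ : ν => a) (fun _ : μ => (1 : ℝ))) := by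
  simpa only [one_smul] using fromBlocks_units_eq_diagonal (ν := ν) (μ := μ) a (1 : ℝ)

/-- [folklore] restricting a two-constant weight along `Sum.map id inl` keeps the two constants. -/
theorem sumElim_const_comp_map {α β γ : Type*} (a b : ℝ) :
    (Sum.elim (fun _ : α => a) (fun _ : β ⊕ γ => b)) ∘ Sum.map id Sum.inl = Sum.elim (fun _ : α => a) (fun _ : β => b) := by
  funext x; cases x <;> rfl

/-- [folklore] (U3) restriction along any map commutes with two-sided DIAGONAL factors (entrywise). -/
theorem submatrix_diagonal_mul_mul_diagonal {ι ι' : Type*} [Fintype ι] [DecidableEq ι] [Fintype ι'] [DecidableEq ι']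
    (u v : ι → ℝ) (X : Matrix ι ι ℝ) (e : ι' → ι) :
    (Matrix.diagonal u * X * Matrix.diagonal v).submatrix e e = Matrix.diagonal (u ∘ e) * X.submatrix e e * Matrix.diagonal (v ∘ e) := by
  ext i j
  simp only [submatrix_apply, diagonal_mul, mul_diagonal, Function.comp_apply]

/-- [folklore] (U4a) the GRADED first-order block under the unit conjugation: `diag(c,1) · fromBlocks H (−Qᵀ) Q 0 · diag(1,c⁻¹) = fromBlocks (c•H) (−Qᵀ) Q 0`. -/
theorem unitConj_graded (c : ℝ) (hc : c ≠ 0) (H : Matrix ν ν ℝ) (Q : Matrix μ ν ℝ) :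
    Matrix.diagonal (Sum.elim (fun _ : ν => c) (fun _ : μ => (1 : ℝ))) * fromBlocks H (-Qᵀ) Q 0
        * Matrix.diagonal (Sum.elim (fun _ : ν => (1 : ℝ)) (fun _ : μ => c⁻¹))
      = fromBlocks (c • H) (-Qᵀ) Q 0 := by
  ext (i | i) (j | j)
  · simp only [diagonal_mul, mul_diagonal, Sum.elim_inl, fromBlocks_apply₁₁, Matrix.smul_apply, smul_eq_mul, mul_one]
  · simp only [diagonal_mul, mul_diagonal, Sum.elim_inl, Sum.elim_inr, fromBlocks_apply₁₂, Matrix.neg_apply, transpose_apply]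
    field_simp
  · simp only [diagonal_mul, mul_diagonal, Sum.elim_inl, Sum.elim_inr, fromBlocks_apply₂₁, one_mul, mul_one]
  · simp only [diagonal_mul, mul_diagonal, Sum.elim_inr, fromBlocks_apply₂₂, Matrix.zero_apply, mul_zero, zero_mul]

/-- [folklore] (U4b) the `kkt`-SHAPED second-order block likewise: `diag(c,1) · kkt H Q · diag(1,c⁻¹) = kkt (c•H) Q`. -/
theorem unitConj_kkt (c : ℝ) (hc : c ≠ 0) (H : Matrix ν ν ℝ) (Q : Matrix μ ν ℝ) :
    Matrix.diagonal (Sum.elim (fun _ : ν => c) (fun _ : μ => (1 : ℝ))) * kkt H Q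
        * Matrix.diagonal (Sum.elim (fun _ : ν => (1 : ℝ)) (fun _ : μ => c⁻¹))
      = kkt (c • H) Q := by
  unfold kkt
  ext (i | i) (j | j)
  · simp only [diagonal_mul, mul_diagonal, Sum.elim_inl, fromBlocks_apply₁₁, Matrix.smul_apply, smul_eq_mul, mul_one]
  · simp only [diagonal_mul, mul_diagonal, Sum.elim_inl, Sum.elim_inr, fromBlocks_apply₁₂, transpose_apply]
    field_simp
  · simp only [diagonal_mul, mul_diagonal, Sum.elim_inl, Sum.elim_inr, fromBlocks_apply₂₁, one_mul, mul_one]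
  · simp only [diagonal_mul, mul_diagonal, Sum.elim_inr, fromBlocks_apply₂₂, Matrix.zero_apply, mul_zero, zero_mul]

/-- [folklore] (U5) **`hessT` UNDER THE UNIT CONJUGATION OF THE LEG**: against graded first-order blocks and a `kkt` second-order block, conjugating the leg by
`diag(1,c⁻¹)`, `diag(c,1)` IS multiplying the three field blocks by `c` (cyclicity of the trace + (U4)). -/
theorem hessT_unitConj (c : ℝ) (hc : c ≠ 0) (P : Matrix (ν ⊕ μ) (ν ⊕ μ) ℝ) (H H' H₂ : Matrix ν ν ℝ) (Q Q' Q₂ : Matrix μ ν ℝ) :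
    hessT (Matrix.diagonal (Sum.elim (fun _ : ν => (1 : ℝ)) (fun _ : μ => c⁻¹)) * P * Matrix.diagonal (Sum.elim (fun _ : ν => c) (fun _ : μ => (1 : ℝ))))
        (fromBlocks H (-Qᵀ) Q 0) (fromBlocks H' (-Q'ᵀ) Q' 0) (kkt H₂ Q₂)
      = hessT P (fromBlocks (c • H) (-Qᵀ) Q 0) (fromBlocks (c • H') (-Q'ᵀ) Q' 0) (kkt (c • H₂) Q₂) := by
  rw [← unitConj_graded c hc H Q, ← unitConj_graded c hc H' Q', ← unitConj_kkt c hc H₂ Q₂]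
  unfold hessT
  set D₁ := Matrix.diagonal (Sum.elim (fun _ : ν => (1 : ℝ)) (fun _ : μ => c⁻¹))
  set D₂ := Matrix.diagonal (Sum.elim (fun _ : ν => c) (fun _ : μ => (1 : ℝ)))
  have h1 : (D₁ * P * D₂ * kkt H₂ Q₂).trace = (P * (D₂ * kkt H₂ Q₂ * D₁)).trace := by
    calc (D₁ * P * D₂ * kkt H₂ Q₂).trace = (D₁ * (P * D₂ * kkt H₂ Q₂)).trace := by simp only [Matrix.mul_assoc]
      _ = (P * D₂ * kkt H₂ Q₂ * D₁).trace := Matrix.trace_mul_comm _ _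
      _ = (P * (D₂ * kkt H₂ Q₂ * D₁)).trace := by simp only [Matrix.mul_assoc]
  have h2 : (D₁ * P * D₂ * fromBlocks H (-Qᵀ) Q 0 * (D₁ * P * D₂ * fromBlocks H' (-Q'ᵀ) Q' 0)).trace
      = (P * (D₂ * fromBlocks H (-Qᵀ) Q 0 * D₁) * (P * (D₂ * fromBlocks H' (-Q'ᵀ) Q' 0 * D₁))).trace := by
    calc (D₁ * P * D₂ * fromBlocks H (-Qᵀ) Q 0 * (D₁ * P * D₂ * fromBlocks H' (-Q'ᵀ) Q' 0)).trace
        = (D₁ * (P * D₂ * fromBlocks H (-Qᵀ) Q 0 * D₁ * P * D₂ * fromBlocks H' (-Q'ᵀ) Q' 0)).trace := by simp only [Matrix.mul_assoc]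
      _ = (P * D₂ * fromBlocks H (-Qᵀ) Q 0 * D₁ * P * D₂ * fromBlocks H' (-Q'ᵀ) Q' 0 * D₁).trace := Matrix.trace_mul_comm _ _
      _ = (P * (D₂ * fromBlocks H (-Qᵀ) Q 0 * D₁) * (P * (D₂ * fromBlocks H' (-Q'ᵀ) Q' 0 * D₁))).trace := by simp only [Matrix.mul_assoc]
  rw [h1, h2]

end Unit

end Summit.QuantumFields.BalabanUV.Beta.FP.KktUnitConjugation

end
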